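import Mathlib
import HarnessLib
import Literature.MathematicalPhysics.QuantumLattice.GaugeGroupsProofs

/-!
# The set of `SU(3)` traces contains the three spokes `ζ·[−1, 3]` (`ζ³ = 1`) and is invariant under conjugation and under the `Z₃` rotation `t ↦ ζ t`

HONEST FRAMING: exact (Metropolis-corrected) sampling algorithms for lattice gauge theory;
figures of merit are autocorrelation/cost numbers at stated couplings and volumes; no
continuum-physics claim.

Venture `LatticeQCDFlow` (cell pub-lqcd), sub-topic `Scoring`; FANOUT row 21 (`su3-base`: the 4D
`SU(3)` baselines).  NEW WORK of the cell (placement rule), elementary, over the Literature file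
`QuantumLattice/GaugeGroupsProofs` (`diagonal_mem_specialUnitaryGroup_iff`); no definition is
introduced; nothing is cited as a fact; no number of ours.  Part of row 21 GEN-8's `SU(3)` trace
series (`SU3TraceLowerBound`: `Re tr` fills `[−3/2, 3]`; `SU3TraceDeltoid`: every trace lies in the
closed deltoid; `SU3RealTraceTorusRepresentative`: the real traces are `1 + 2cos θ`).  Here: which
complex numbers ARE traces — explicit witnesses and the two symmetries of the trace set.

* For every real `θ` and every cube root of unity `ζ`, the diagonal matrix
  `diag(ζ, ζe^{iθ}, ζe^{−iθ})` lies in `SU(3)` and has trace `ζ(1 + 2cos θ)`; as `θ` ranges over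
  `[0, π]` the factor `1 + 2cos θ` sweeps `[−1, 3]`, so the three SPOKES `ζ·[−1, 3]` of the deltoid
  (through the cusps `3ζ` and the origin) consist of traces (`mem_range_trace_spoke`).
* The trace set is closed under complex conjugation (`tr U⁻¹ = conj tr U`) and under multiplication
  by cube roots of unity (`ζU ∈ SU(3)`): `conj_mem_range_trace`, `rootOfUnity_mul_mem_range_trace`.

## What is proved

* `spokeDiag_mem` — `diag(ζ, ζe^{iθ}, ζe^{−iθ}) ∈ SU(3)` for `ζ³ = 1`; `trace_spokeDiag` — its trace
  is `ζ (1 + 2cos θ)`;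
* **`mem_range_trace_spoke`** — `ζ³ = 1`, `s ∈ [−1, 3] ⟹ ζ s` is the trace of some `U ∈ SU(3)`;
  in particular `mem_range_trace_real` (`s ∈ [−1, 3]` real) and `zero_mem_range_trace`;
* **`conj_mem_range_trace`**, **`rootOfUnity_mul_mem_range_trace`** — the two symmetries.

NOT CLAIMED: that the trace set IS the full closed deltoid (surjectivity onto the region between the
spokes is not proved here); anything for `N ≠ 3`.
-/

namespace Summit.Ventures.LatticeQCDFlow.Scoring

open Matrix Complex
open Literature.MathematicalPhysics.QuantumLattice

section SpecialUnitaryThree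

/-- The spoke witness `diag(ζ, ζe^{iθ}, ζe^{−iθ})` lies in `SU(3)` when `ζ³ = 1`. -/
theorem spokeDiag_mem {ζ : ℂ} (hζ : ζ ^ 3 = 1) (θ : ℝ) :
    Matrix.diagonal (![ζ, ζ * Complex.exp ((θ : ℂ) * Complex.I), ζ * Complex.exp (-((θ : ℂ) * Complex.I))]
      : Fin 3 → ℂ) ∈ Matrix.specialUnitaryGroup (Fin 3) ℂ := by
  have hn : ‖ζ‖ = 1 := by
    have h : ‖ζ‖ ^ 3 = 1 := by rw [← norm_pow, hζ, norm_one]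
    exact (pow_eq_one_iff_of_nonneg (norm_nonneg ζ) (by norm_num)).mp h
  have hneg : -((θ : ℂ) * Complex.I) = ((-θ : ℝ) : ℂ) * Complex.I := by push_cast; ring
  rw [diagonal_mem_specialUnitaryGroup_iff]
  refine ⟨fun i => ?_, ?_⟩
  · fin_cases i
    · simpa using hn
    · simp only [Fin.mk_one, Matrix.cons_val_one, Matrix.cons_val_zero, norm_mul, hn, one_mul]
      exact Complex.norm_exp_ofReal_mul_I θ
    · simp only [Fin.reduceFinMk, Matrix.cons_val, norm_mul, hn, one_mul]
      rw [hneg]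
      exact Complex.norm_exp_ofReal_mul_I (-θ)
  · rw [Fin.prod_univ_three]
    simp only [Matrix.cons_val_zero, Matrix.cons_val_one, Matrix.cons_val]
    calc ζ * (ζ * Complex.exp ((θ : ℂ) * Complex.I)) * (ζ * Complex.exp (-((θ : ℂ) * Complex.I)))
        = ζ ^ 3 * (Complex.exp ((θ : ℂ) * Complex.I) * Complex.exp (-((θ : ℂ) * Complex.I))) := by ring
      _ = 1 := by rw [hζ, ← Complex.exp_add, add_neg_cancel, Complex.exp_zero, one_mul]

/-- The trace of the spoke witness is `ζ (1 + 2 cos θ)`. -/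
theorem trace_spokeDiag (ζ : ℂ) (θ : ℝ) :
    (Matrix.diagonal (![ζ, ζ * Complex.exp ((θ : ℂ) * Complex.I), ζ * Complex.exp (-((θ : ℂ) * Complex.I))]
      : Fin 3 → ℂ)).trace = ζ * ((1 + 2 * Real.cos θ : ℝ) : ℂ) := by
  rw [trace_diagonal, Fin.sum_univ_three]
  simp only [Matrix.cons_val_zero, Matrix.cons_val_one, Matrix.cons_val]
  rw [show -((θ : ℂ) * Complex.I) = (-(θ : ℂ)) * Complex.I by ring, ← Complex.cos_add_sin_I,
    ← Complex.cos_add_sin_I, Complex.cos_neg, Complex.sin_neg, ← Complex.ofReal_cos]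
  push_cast
  ring

/-- **The three spokes consist of traces**: for `ζ³ = 1` and `s ∈ [−1, 3]`, `ζ s = tr U` for some
`U ∈ SU(3)` (take `θ = arccos((s − 1)/2)`). -/
theorem mem_range_trace_spoke {ζ : ℂ} (hζ : ζ ^ 3 = 1) {s : ℝ} (hs : s ∈ Set.Icc (-1 : ℝ) 3) :
    ∃ U : Matrix.specialUnitaryGroup (Fin 3) ℂ, (U : Matrix (Fin 3) (Fin 3) ℂ).trace = ζ * (s : ℂ) := by
  set θ : ℝ := Real.arccos ((s - 1) / 2) with hθ
  refine ⟨⟨_, spokeDiag_mem hζ θ⟩, ?_⟩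
  change (Matrix.diagonal _).trace = _
  rw [trace_spokeDiag, hθ, Real.cos_arccos (by linarith [hs.1]) (by linarith [hs.2])]
  congr 1
  push_cast
  ring

/-- In particular every real number in `[−1, 3]` is an `SU(3)` trace. -/
theorem mem_range_trace_real {s : ℝ} (hs : s ∈ Set.Icc (-1 : ℝ) 3) :
    ∃ U : Matrix.specialUnitaryGroup (Fin 3) ℂ, (U : Matrix (Fin 3) (Fin 3) ℂ).trace = (s : ℂ) := by
  obtain ⟨U, hU⟩ := mem_range_trace_spoke (ζ := 1) (by norm_num) hs
  exact ⟨U, by rw [hU, one_mul]⟩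

/-- `0` is an `SU(3)` trace (the centre of the deltoid; eigenvalues `1, e^{2πi/3}, e^{−2πi/3}`). -/
theorem zero_mem_range_trace :
    ∃ U : Matrix.specialUnitaryGroup (Fin 3) ℂ, (U : Matrix (Fin 3) (Fin 3) ℂ).trace = 0 := by
  obtain ⟨U, hU⟩ := mem_range_trace_real (s := 0) ⟨by norm_num, by norm_num⟩
  exact ⟨U, by rw [hU]; simp⟩

/-- **The trace set is closed under conjugation**: `tr U⁻¹ = conj (tr U)`. -/
theorem conj_mem_range_trace (U : Matrix.specialUnitaryGroup (Fin 3) ℂ) :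
    ∃ V : Matrix.specialUnitaryGroup (Fin 3) ℂ,
      (V : Matrix (Fin 3) (Fin 3) ℂ).trace = (starRingEnd ℂ) (U : Matrix (Fin 3) (Fin 3) ℂ).trace := by
  refine ⟨U⁻¹, ?_⟩
  change (star (U : Matrix (Fin 3) (Fin 3) ℂ)).trace = _
  rw [star_eq_conjTranspose, trace_conjTranspose, Complex.star_def]

/-- **The trace set is `Z₃`-invariant**: `ζ³ = 1 ⟹ ζ·tr U = tr (ζU)` with `ζU ∈ SU(3)`. -/
theorem rootOfUnity_mul_mem_range_trace {ζ : ℂ} (hζ : ζ ^ 3 = 1)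
    (U : Matrix.specialUnitaryGroup (Fin 3) ℂ) :
    ∃ V : Matrix.specialUnitaryGroup (Fin 3) ℂ,
      (V : Matrix (Fin 3) (Fin 3) ℂ).trace = ζ * (U : Matrix (Fin 3) (Fin 3) ℂ).trace := by
  have hn : ‖ζ‖ = 1 := by
    have h : ‖ζ‖ ^ 3 = 1 := by rw [← norm_pow, hζ, norm_one]
    exact (pow_eq_one_iff_of_nonneg (norm_nonneg ζ) (by norm_num)).mp h
  have hζζ : (starRingEnd ℂ) ζ * ζ = 1 := by
    rw [← Complex.normSq_eq_conj_mul_self, Complex.normSq_eq_norm_sq, hn]; norm_num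
  have hmem : ζ • (U : Matrix (Fin 3) (Fin 3) ℂ) ∈ Matrix.specialUnitaryGroup (Fin 3) ℂ := by
    rw [Matrix.mem_specialUnitaryGroup_iff]
    refine ⟨?_, ?_⟩
    · rw [Matrix.mem_unitaryGroup_iff']
      rw [star_smul, Matrix.smul_mul, Matrix.mul_smul, Unitary.star_mul_self_of_mem U.2.1, smul_smul,
        Complex.star_def, hζζ, one_smul]
    · rw [det_smul, Fintype.card_fin, hζ, one_mul]
      exact (Matrix.mem_specialUnitaryGroup_iff.mp U.2).2
  refine ⟨⟨_, hmem⟩, ?_⟩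
  change (ζ • (U : Matrix (Fin 3) (Fin 3) ℂ)).trace = _
  rw [Matrix.trace_smul, smul_eq_mul]

end SpecialUnitaryThree

end Summit.Ventures.LatticeQCDFlow.Scoring
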